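import Summits.QuantumFields.QCD.Theses.SpectralDefectExtinction
import Summits.QuantumFields.QCD.Theorems.ExtinctionBuildsQCD.Negative.WithoutTightCollapse
import Summits.QuantumFields.QCD.Theorems.ExtinctionBuildsQCD.Negative.VolumeLever
import Summits.QuantumFields.QCD.Theorems.TipPricing.Negative.HeavySideDOSFreeSide
import Summits.QuantumFields.QCD.Theorems.SpectralDefectExtinctionAFBookkeeping
import Literature.MathematicalPhysics.QuantumFieldTheory.QCDPhaseQuenched
import Literature.MathematicalPhysics.QuantumFieldTheory.QCDPhaseQuenchedReweighting

/-!
# Stub `stub_freeSideGlue` of line `hermitian-flow-coarea` (reshape r2) for crux `TipPricing`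
(stmt-QuantumFields-8967): C⁺ (fixed-coupling deep-subcritical index spreading for `N_f = 2, 3`) ⇒ `LifshitzTight`.

Port of the PROVED §2 reduction of the sibling crux 8964's skeleton
`Summits/QuantumFields/QCD/Cruxes/WindowExtinction/Lines/free_volume_heavy_witness.lean`
(`tightRatio_canonicalAF_eq`, `one_le_canonicalAF_Zm`, `canonicalAF_β_nonneg/_le`,
`schemeIndexSpread_of_fixedCouplingSub`, `tight_tipReg_of_schemeIndexSpread`,
`sdHyp_of_fixedCouplingIndexSpreadSub`; adapted: definitions unfolded into tree vocabulary), followed by the landed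
`heavySideDOS_of_mcrit_nonneg` (Theorems/TipPricing/Negative/HeavySideDOSFreeSide).  Supports stmt-QuantumFields-8967.
-/

noncomputable section

namespace Summit.QuantumFields.QCD.Cruxes.TipPricing.HermitianFlowCoarea

open scoped BigOperators Topology Classical MeasureTheory Matrix ComplexConjugate
open Filter MeasureTheory
open Literature.MathematicalPhysics.QuantumLattice Literature.MathematicalPhysics.QuantumFieldTheory
  Literature.Probability.LatticeModels
open Summit.QuantumFields.QCD.Theses.SpectralDefectExtinction
open Summit.QuantumFields.QCD.Theorems.ExtinctionBuildsQCD.Negative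

/-! ## Ported reduction (fixed-coupling spread ⇒ scheme spread ⇒ TIGHT tip witness)

-- adapted from Cruxes/WindowExtinction/Lines/free_volume_heavy_witness.lean §2 (lead prover-line-stmt-QuantumFields-8964-0 and -1)
(the local definitions `negCount`, `deepIndex`, `absIndexMean`, `FixedCouplingIndexSpreadSub`,
`SchemeIndexSpread` of that skeleton are not importable and are inlined here as explicit formulas;
every ported lemma carries the prefix `glue_`). -/

section GlueReduction

variable {Nf : ℕ}

/-- The TIGHT ratio of `canonicalAF` at step `k` on the torus `2L'+1` IS the phase-quenched mean
(`qcdPhaseQuenchedExpect`, flavour-product form) of `|n₋(Γ₅ D_W(U, -δ, 1)) - 6(2L'+1)⁴|` at `β = β_k`,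
`δ = a_k M/Z_k`, weights at `μ_f = a_k m_f/Z_k` (line `m_crit = 0`).
-- adapted from Cruxes/WindowExtinction/Lines/free_volume_heavy_witness.lean §2 (lead prover-line-stmt-QuantumFields-8964-0 and -1) -/
theorem glue_tightRatio_canonicalAF_eq (k L' : ℕ) (m : Fin Nf → ℝ) (M : ℝ) :
    tightRatio (QCDRegularisation.canonicalAF Nf) k L' m M =
      qcdPhaseQuenchedExpect ((QCDRegularisation.canonicalAF Nf).β k) (2 * L' + 1)
        (fun f => (QCDRegularisation.canonicalAF Nf).a k * m f / (QCDRegularisation.canonicalAF Nf).Zm k)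
        (fun U : GaugeConfig 4 (2 * L' + 1) SU3 => |(Multiset.countP (fun z : ℂ => z.re < 0)
          (spinorLift gammaFive * wilsonDirac (fundamentalRep (Fin 3)) U
            (-((QCDRegularisation.canonicalAF Nf).a k * M / (QCDRegularisation.canonicalAF Nf).Zm k))
            1).charpoly.roots : ℝ) - 6 * (2 * (L' : ℝ) + 1) ^ 4|) := by
  have h0 : ∀ j, (QCDRegularisation.canonicalAF Nf).mcrit j = 0 := fun _ => rfl
  rw [qcdPhaseQuenchedExpect_eq_div_prod]
  simp only [tightRatio, h0, zero_sub, zero_add]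

/-- `γ₀/(2β₀) ≥ 0` for `N_f ≤ 16` (asymptotic freedom: `β₀ > 0`).
-- adapted from Cruxes/WindowExtinction/Lines/free_volume_heavy_witness.lean §2 (lead prover-line-stmt-QuantumFields-8964-0 and -1) -/
theorem glue_massExponent_nonneg (hNf : Nf ≤ 16) : 0 ≤ massExponent Nf := by
  have h16 : (Nf : ℝ) ≤ 16 := by exact_mod_cast hNf
  have hb : 0 < 11 - 2 * (Nf : ℝ) / 3 := by linarith
  have hπ : 0 < 16 * Real.pi ^ 2 := by positivity
  unfold massExponent gammaCoeff₀ betaCoeff₀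
  exact div_nonneg (div_nonneg (by norm_num) hπ.le) (mul_nonneg (by norm_num) (div_nonneg hb.le hπ.le))

/-- `Z_m(k) ≥ 1` along `canonicalAF` (for `N_f ≤ 16`): `Z_0 = 1` and `Z_k = (log (k+1)²)^{γ₀/(2β₀)}` with
`log (k+1)² ≥ log 4 ≥ 1` for `k ≥ 1`.
-- adapted from Cruxes/WindowExtinction/Lines/free_volume_heavy_witness.lean §2 (lead prover-line-stmt-QuantumFields-8964-0 and -1) -/
theorem glue_one_le_canonicalAF_Zm (hNf : Nf ≤ 16) (k : ℕ) :
    1 ≤ (QCDRegularisation.canonicalAF Nf).Zm k := by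
  change 1 ≤ (if k = 0 then (1 : ℝ) else
    Real.log (1 / (QCDScheme.zeroAF Nf).a k ^ 2) ^ massExponent Nf)
  split_ifs with hk
  · exact le_rfl
  · refine Real.one_le_rpow ?_ (glue_massExponent_nonneg hNf)
    have ha : (QCDScheme.zeroAF Nf).a k = ((k : ℝ) + 1)⁻¹ := rfl
    have hk1 : (1 : ℝ) ≤ k := by exact_mod_cast Nat.one_le_iff_ne_zero.2 hk
    have hx : (4 : ℝ) ≤ 1 / (QCDScheme.zeroAF Nf).a k ^ 2 := by
      rw [ha, inv_pow, one_div, inv_inv]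
      nlinarith
    have hpos : 0 < 1 / (QCDScheme.zeroAF Nf).a k ^ 2 := by linarith
    rw [Real.le_log_iff_exp_le hpos]
    linarith [Real.exp_one_lt_three]

/-- `β_k = afBeta N_f 1 a_k` along `canonicalAF` (Λ = 1).
-- adapted from Cruxes/WindowExtinction/Lines/free_volume_heavy_witness.lean §2 (lead prover-line-stmt-QuantumFields-8964-0 and -1) -/
theorem glue_canonicalAF_β (k : ℕ) :
    (QCDRegularisation.canonicalAF Nf).β k = afBeta Nf 1 (((k : ℝ) + 1)⁻¹) := rfl

/-- The two-loop profile at `Λ = 1`, `a = (k+1)⁻¹`, written in the variable `log (k+1)²`.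
-- adapted from Cruxes/WindowExtinction/Lines/free_volume_heavy_witness.lean §2 (lead prover-line-stmt-QuantumFields-8964-0 and -1) -/
theorem glue_afBeta_one_canonical_eq (k : ℕ) :
    afBeta Nf 1 (((k : ℝ) + 1)⁻¹) = 2 * betaCoeff₀ Nf * Real.log (((k : ℝ) + 1) ^ 2) +
      2 * (betaCoeff₁ Nf / betaCoeff₀ Nf) * Real.log (Real.log (((k : ℝ) + 1) ^ 2)) := by
  have hx : (1 : ℝ) / ((((k : ℝ) + 1)⁻¹) ^ 2 * 1 ^ 2) = ((k : ℝ) + 1) ^ 2 := by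
    field_simp
  unfold afBeta
  rw [hx]

/-- `b₁ = (102 − 38N_f/3)/(16π²)² ≥ 0` for `N_f ≤ 8`.
-- adapted from Cruxes/WindowExtinction/Lines/free_volume_heavy_witness.lean §2 (lead prover-line-stmt-QuantumFields-8964-0 and -1) -/
theorem glue_betaCoeff₁_nonneg_of_le_eight (hNf : Nf ≤ 8) : 0 ≤ betaCoeff₁ Nf := by
  unfold betaCoeff₁
  have h : (Nf : ℝ) ≤ 8 := by exact_mod_cast hNf
  have hπ : 0 < (16 * Real.pi ^ 2) ^ 2 := by positivity
  exact div_nonneg (by linarith) hπ.le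

/-- `1 ≤ log (k+1)²` for `k ≥ 1` (since `(k+1)² ≥ 4 > e`).
-- adapted from Cruxes/WindowExtinction/Lines/free_volume_heavy_witness.lean §2 (lead prover-line-stmt-QuantumFields-8964-0 and -1) -/
theorem glue_one_le_log_sq_succ {k : ℕ} (hk : 1 ≤ k) : 1 ≤ Real.log (((k : ℝ) + 1) ^ 2) := by
  have hk' : (1 : ℝ) ≤ k := by exact_mod_cast hk
  have h4 : Real.exp 1 ≤ ((k : ℝ) + 1) ^ 2 := by
    have := Real.exp_one_lt_d9
    nlinarith
  rw [Real.le_log_iff_exp_le (by positivity)]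
  exact h4

/-- `log (k+1)² ≤ 4 √(k+1)`.
-- adapted from Cruxes/WindowExtinction/Lines/free_volume_heavy_witness.lean §2 (lead prover-line-stmt-QuantumFields-8964-0 and -1) -/
theorem glue_log_sq_succ_le_sqrt (k : ℕ) :
    Real.log (((k : ℝ) + 1) ^ 2) ≤ 4 * Real.sqrt ((k : ℝ) + 1) := by
  have hy : (0 : ℝ) < (k : ℝ) + 1 := by positivity
  have hs : 0 < Real.sqrt ((k : ℝ) + 1) := Real.sqrt_pos.2 hy
  have h1 : Real.log (Real.sqrt ((k : ℝ) + 1)) ≤ Real.sqrt ((k : ℝ) + 1) - 1 :=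
    Real.log_le_sub_one_of_pos hs
  have h2 : Real.log (((k : ℝ) + 1) ^ 2) = 4 * Real.log (Real.sqrt ((k : ℝ) + 1)) := by
    have : ((k : ℝ) + 1) ^ 2 = Real.sqrt ((k : ℝ) + 1) ^ 4 := by
      rw [show (4 : ℕ) = 2 * 2 from rfl, pow_mul, Real.sq_sqrt hy.le]
    rw [this, Real.log_pow]
    push_cast
    ring
  rw [h2]
  linarith

/-- `0 ≤ β_k` along `canonicalAF` for `k ≥ 1` and `N_f ≤ 8`.
-- adapted from Cruxes/WindowExtinction/Lines/free_volume_heavy_witness.lean §2 (lead prover-line-stmt-QuantumFields-8964-0 and -1) -/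
theorem glue_canonicalAF_β_nonneg (hNf : Nf ≤ 8) {k : ℕ} (hk : 1 ≤ k) :
    0 ≤ (QCDRegularisation.canonicalAF Nf).β k := by
  rw [glue_canonicalAF_β, glue_afBeta_one_canonical_eq]
  have hb₀ : 0 < betaCoeff₀ Nf :=
    Summit.QuantumFields.QCD.Theorems.betaCoeff₀_pos_of_le_sixteen (by omega)
  have hb₁ : 0 ≤ betaCoeff₁ Nf := glue_betaCoeff₁_nonneg_of_le_eight hNf
  have hℓ : 1 ≤ Real.log (((k : ℝ) + 1) ^ 2) := glue_one_le_log_sq_succ hk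
  have hℓ0 : 0 ≤ Real.log (((k : ℝ) + 1) ^ 2) := zero_le_one.trans hℓ
  have hll : 0 ≤ Real.log (Real.log (((k : ℝ) + 1) ^ 2)) := Real.log_nonneg hℓ
  have : 0 ≤ betaCoeff₁ Nf / betaCoeff₀ Nf := div_nonneg hb₁ hb₀.le
  positivity

/-- `β_k ≤ 8(b₀ + b₁/b₀) √(k+1)` along `canonicalAF` for `k ≥ 1` and `N_f ≤ 8`.
-- adapted from Cruxes/WindowExtinction/Lines/free_volume_heavy_witness.lean §2 (lead prover-line-stmt-QuantumFields-8964-0 and -1) -/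
theorem glue_canonicalAF_β_le (hNf : Nf ≤ 8) {k : ℕ} (hk : 1 ≤ k) :
    (QCDRegularisation.canonicalAF Nf).β k ≤
      8 * (betaCoeff₀ Nf + betaCoeff₁ Nf / betaCoeff₀ Nf) * Real.sqrt ((k : ℝ) + 1) := by
  rw [glue_canonicalAF_β, glue_afBeta_one_canonical_eq]
  have hb₀ : 0 < betaCoeff₀ Nf :=
    Summit.QuantumFields.QCD.Theorems.betaCoeff₀_pos_of_le_sixteen (by omega)
  have hb₁ : 0 ≤ betaCoeff₁ Nf := glue_betaCoeff₁_nonneg_of_le_eight hNf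
  have hr : 0 ≤ betaCoeff₁ Nf / betaCoeff₀ Nf := div_nonneg hb₁ hb₀.le
  set ℓ : ℝ := Real.log (((k : ℝ) + 1) ^ 2) with hℓdef
  have hℓ1 : 1 ≤ ℓ := glue_one_le_log_sq_succ hk
  have hℓs : ℓ ≤ 4 * Real.sqrt ((k : ℝ) + 1) := glue_log_sq_succ_le_sqrt k
  have hlogℓ : Real.log ℓ ≤ 4 * Real.sqrt ((k : ℝ) + 1) := by
    have := Real.log_le_sub_one_of_pos (zero_lt_one.trans_le hℓ1)
    linarith
  have h1 : 2 * betaCoeff₀ Nf * ℓ ≤ 2 * betaCoeff₀ Nf * (4 * Real.sqrt ((k : ℝ) + 1)) :=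
    mul_le_mul_of_nonneg_left hℓs (by positivity)
  have h2 : 2 * (betaCoeff₁ Nf / betaCoeff₀ Nf) * Real.log ℓ ≤
      2 * (betaCoeff₁ Nf / betaCoeff₀ Nf) * (4 * Real.sqrt ((k : ℝ) + 1)) :=
    mul_le_mul_of_nonneg_left hlogℓ (by positivity)
  linarith

/-- **Fixed-coupling (deep-subcritical) spread ⇒ scheme spread** (`N_f ≤ 8`): at step `k` the window
`[(K+1)⁻¹, K+1]` of masses/probes is mapped by `x ↦ a_k x / Z_k` onto `[lo_k, hi_k]`, of aspect ratio exactly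
`(K+1)²` and top `hi_k = a_k (K+1)/Z_k ≤ (K+1)/(k+1)` (`Z_k ≥ 1`); with `0 ≤ β_k ≤ 8(b₀+b₁/b₀)√(k+1)` (`k ≥ 1`)
the window is deep-subcritical, `hi_k · max β_k 1 ≤ (K+1)·max(8(b₀+b₁/b₀),1)/√(k+1) ≤ h₀`, once
`k + 1 ≥ ((K+1)·max(8(b₀+b₁/b₀),1)/h₀)²`; there C⁺ applies at `β = β_k`.  (The hypothesis is the sibling
skeleton's `FixedCouplingIndexSpreadSub N_f` with `absIndexMean` unfolded; the conclusion is its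
`SchemeIndexSpread N_f` unfolded.)
-- adapted from Cruxes/WindowExtinction/Lines/free_volume_heavy_witness.lean §2 (lead prover-line-stmt-QuantumFields-8964-0 and -1) -/
theorem glue_schemeIndexSpread_of_fixedCouplingSub (hNf : Nf ≤ 8)
    (h : ∀ Q : ℕ, ∃ h₀ : ℝ, 0 < h₀ ∧ ∀ β lo hi : ℝ, 0 ≤ β → 0 < lo → lo ≤ hi →
      hi ≤ Q * lo → hi * max β 1 ≤ h₀ → ∀ L₀ : ℕ, ∃ L' : ℕ, L₀ ≤ L' ∧ ∀ δ : ℝ, lo ≤ δ → δ ≤ hi →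
      ∀ μ : Fin Nf → ℝ, (∀ f, lo ≤ μ f ∧ μ f ≤ hi) → 1 ≤ qcdPhaseQuenchedExpect β (2 * L' + 1) μ
      (fun U : GaugeConfig 4 (2 * L' + 1) SU3 => |(Multiset.countP (fun z : ℂ => z.re < 0) (spinorLift
      gammaFive * wilsonDirac (fundamentalRep (Fin 3)) U (-δ) 1).charpoly.roots : ℝ) - 6 * (2 * (L' : ℝ) +
      1) ^ 4|)) :
    ∀ K : ℕ, ∃ k₀ : ℕ, ∀ k : ℕ, k₀ ≤ k → ∀ L₀ : ℕ, ∃ L' : ℕ, L₀ ≤ L' ∧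
      ∀ m : Fin Nf → ℝ, (∀ f, ((K : ℝ) + 1)⁻¹ ≤ m f ∧ m f ≤ K + 1) →
        ∀ M : ℝ, ((K : ℝ) + 1)⁻¹ ≤ M → M ≤ K + 1 →
          1 ≤ tightRatio (QCDRegularisation.canonicalAF Nf) k L' m M := by
  intro K
  obtain ⟨h₀, hh₀, hP⟩ := h ((K + 1) ^ 2)
  set Cβ : ℝ := 8 * (betaCoeff₀ Nf + betaCoeff₁ Nf / betaCoeff₀ Nf) with hCβ
  set Mx : ℝ := ((K : ℝ) + 1) * max Cβ 1 / h₀ with hMx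
  refine ⟨max 1 ⌈Mx ^ 2⌉₊, fun k hk L₀ => ?_⟩
  have hk1 : 1 ≤ k := le_of_max_le_left hk
  have hkM : ⌈Mx ^ 2⌉₊ ≤ k := le_of_max_le_right hk
  set can := QCDRegularisation.canonicalAF Nf with hcan
  have ha : can.a k = ((k : ℝ) + 1)⁻¹ := rfl
  have hapos : 0 < can.a k := can.a_pos k
  have hZ1 : 1 ≤ can.Zm k := glue_one_le_canonicalAF_Zm (by omega) k
  have hZpos : 0 < can.Zm k := can.Zm_pos k
  have hK1 : (0 : ℝ) < (K : ℝ) + 1 := by positivity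
  have hk1' : (0 : ℝ) < (k : ℝ) + 1 := by positivity
  have hβ0 : 0 ≤ can.β k := glue_canonicalAF_β_nonneg hNf hk1
  have hβle : can.β k ≤ Cβ * Real.sqrt ((k : ℝ) + 1) := glue_canonicalAF_β_le hNf hk1
  -- the window at step k
  set lo : ℝ := can.a k * ((K : ℝ) + 1)⁻¹ / can.Zm k with hlo
  set hi : ℝ := can.a k * ((K : ℝ) + 1) / can.Zm k with hhi
  have hmono : ∀ x y : ℝ, x ≤ y → can.a k * x / can.Zm k ≤ can.a k * y / can.Zm k := fun x y hxy =>
    div_le_div_of_nonneg_right (mul_le_mul_of_nonneg_left hxy hapos.le) hZpos.le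
  have hlo_pos : 0 < lo := div_pos (mul_pos hapos (inv_pos.2 hK1)) hZpos
  have hlohi : lo ≤ hi := hmono _ _ (by
    have : ((K : ℝ) + 1)⁻¹ ≤ 1 := inv_le_one_of_one_le₀ (by linarith)
    linarith)
  -- aspect ratio exactly (K+1)²
  have hQ : hi ≤ (((K + 1) ^ 2 : ℕ) : ℝ) * lo := by
    apply le_of_eq
    simp only [hhi, hlo]
    push_cast
    field_simp
  -- the top of the window: hi ≤ (K+1)/(k+1)
  have hhi_le : hi ≤ ((K : ℝ) + 1) / ((k : ℝ) + 1) := by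
    calc hi = can.a k * ((K : ℝ) + 1) / can.Zm k := rfl
      _ ≤ can.a k * ((K : ℝ) + 1) / 1 := div_le_div_of_nonneg_left (by positivity) one_pos hZ1
      _ = ((K : ℝ) + 1) / ((k : ℝ) + 1) := by rw [div_one, ha, inv_mul_eq_div]
  -- deep-subcritical: hi * max β 1 ≤ h₀
  have hsqrt1 : 1 ≤ Real.sqrt ((k : ℝ) + 1) :=
    (Real.le_sqrt' one_pos).2 (by rw [one_pow]; linarith)
  have hsqrt_pos : 0 < Real.sqrt ((k : ℝ) + 1) := zero_lt_one.trans_le hsqrt1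
  have hmax : max (can.β k) 1 ≤ max Cβ 1 * Real.sqrt ((k : ℝ) + 1) := by
    refine max_le ?_ ?_
    · exact hβle.trans (mul_le_mul_of_nonneg_right (le_max_left _ _) hsqrt_pos.le)
    · calc (1 : ℝ) = 1 * 1 := (mul_one _).symm
        _ ≤ max Cβ 1 * Real.sqrt ((k : ℝ) + 1) :=
          mul_le_mul (le_max_right _ _) hsqrt1 zero_le_one (zero_le_one.trans (le_max_right _ _))
  have hMx_le : Mx ≤ Real.sqrt ((k : ℝ) + 1) := by
    have h1 : Mx ^ 2 ≤ (k : ℝ) + 1 := by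
      have := (Nat.ceil_le.1 hkM)
      have h2 : Mx ^ 2 ≤ (⌈Mx ^ 2⌉₊ : ℝ) := Nat.le_ceil _
      linarith
    by_cases hMx0 : 0 ≤ Mx
    · calc Mx = Real.sqrt (Mx ^ 2) := (Real.sqrt_sq hMx0).symm
        _ ≤ Real.sqrt ((k : ℝ) + 1) := Real.sqrt_le_sqrt h1
    · exact (lt_of_not_ge hMx0).le.trans hsqrt_pos.le
  have hsub : hi * max (can.β k) 1 ≤ h₀ := by
    have hC1 : 0 < max Cβ 1 := zero_lt_one.trans_le (le_max_right _ _)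
    -- (K+1) max(Cβ,1) ≤ h₀ √(k+1)
    have hkey : ((K : ℝ) + 1) * max Cβ 1 ≤ h₀ * Real.sqrt ((k : ℝ) + 1) := by
      have := mul_le_mul_of_nonneg_left hMx_le hh₀.le
      rwa [hMx, mul_div_cancel₀ _ hh₀.ne'] at this
    calc hi * max (can.β k) 1
        ≤ ((K : ℝ) + 1) / ((k : ℝ) + 1) * (max Cβ 1 * Real.sqrt ((k : ℝ) + 1)) :=
          mul_le_mul hhi_le hmax (le_trans zero_le_one (le_max_right _ _)) (by positivity)
      _ = ((K : ℝ) + 1) * max Cβ 1 * Real.sqrt ((k : ℝ) + 1) / ((k : ℝ) + 1) := by ring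
      _ ≤ h₀ * Real.sqrt ((k : ℝ) + 1) * Real.sqrt ((k : ℝ) + 1) / ((k : ℝ) + 1) :=
          div_le_div_of_nonneg_right (mul_le_mul_of_nonneg_right hkey hsqrt_pos.le) hk1'.le
      _ = h₀ := by
          rw [mul_assoc, Real.mul_self_sqrt hk1'.le, mul_div_assoc, div_self hk1'.ne', mul_one]
  obtain ⟨L', hL', hP'⟩ := hP (can.β k) lo hi hβ0 hlo_pos hlohi hQ hsub L₀
  refine ⟨L', hL', fun m hm M hM1 hM2 => ?_⟩
  rw [glue_tightRatio_canonicalAF_eq]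
  exact hP' _ (hmono _ _ hM1) (hmono _ _ hM2) _ fun f => ⟨hmono _ _ (hm f).1, hmono _ _ (hm f).2⟩

/-- **Scheme spread ⇒ the tip family is TIGHT** (threshold `M₀ = 0`), by a diagonal choice of the free
volumes: at step `k` use the largest range index `K ≤ k` whose (monotonised) threshold `k₁ K ≤ k` has been
passed, and the good volume C⁺ provides above `can.L k` (so `a_k L_k → ∞` is kept).  (The hypothesis is the
sibling skeleton's `SchemeIndexSpread N_f` unfolded.)
-- adapted from Cruxes/WindowExtinction/Lines/free_volume_heavy_witness.lean §2 (lead prover-line-stmt-QuantumFields-8964-0 and -1) -/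
theorem glue_tight_tipReg_of_schemeIndexSpread
    (h : ∀ K : ℕ, ∃ k₀ : ℕ, ∀ k : ℕ, k₀ ≤ k → ∀ L₀ : ℕ, ∃ L' : ℕ, L₀ ≤ L' ∧
      ∀ m : Fin Nf → ℝ, (∀ f, ((K : ℝ) + 1)⁻¹ ≤ m f ∧ m f ≤ K + 1) →
        ∀ M : ℝ, ((K : ℝ) + 1)⁻¹ ≤ M → M ≤ K + 1 →
          1 ≤ tightRatio (QCDRegularisation.canonicalAF Nf) k L' m M) :
    ∃ (L' : ℕ → ℕ) (hL' : Tendsto (fun k => (QCDRegularisation.canonicalAF Nf).a k * L' k) atTop atTop),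
      ∀ m : Fin Nf → ℝ, (∀ f, 0 < m f) → Tight Nf (tipReg Nf L' hL') 0 m := by
  classical
  set can := QCDRegularisation.canonicalAF Nf with hcan
  choose k₀ hk₀ using h
  -- monotone majorant of the thresholds
  let k₁ : ℕ → ℕ := fun K => (Finset.range (K + 1)).sup k₀
  have hk₁ : ∀ K' K, K' ≤ K → k₀ K' ≤ k₁ K := fun K' K hK =>
    Finset.le_sup (f := k₀) (Finset.mem_range.2 (Nat.lt_succ_of_le hK))
  -- the range index used at step k
  let Ks : ℕ → ℕ := fun k => Nat.findGreatest (fun K => k₁ K ≤ k) k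
  -- a volume at step k, good for the range `Ks k` whenever that range is available
  have hvol : ∀ k, ∃ L' : ℕ, can.L k ≤ L' ∧ (k₁ (Ks k) ≤ k →
      ∀ m : Fin Nf → ℝ, (∀ f, ((Ks k : ℝ) + 1)⁻¹ ≤ m f ∧ m f ≤ Ks k + 1) →
        ∀ M : ℝ, ((Ks k : ℝ) + 1)⁻¹ ≤ M → M ≤ Ks k + 1 → 1 ≤ tightRatio can k L' m M) := by
    intro k
    by_cases hc : k₁ (Ks k) ≤ k
    · obtain ⟨L', hL', hP⟩ := hk₀ (Ks k) k ((hk₁ _ _ le_rfl).trans hc) (can.L k)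
      exact ⟨L', hL', fun _ => hP⟩
    · exact ⟨can.L k, le_rfl, fun h' => absurd h' hc⟩
  choose L hLge hLP using hvol
  have hL : Tendsto (fun k => can.a k * L k) atTop atTop := by
    refine tendsto_atTop_mono (fun k => ?_) can.tendsto_L
    exact mul_le_mul_of_nonneg_left (by exact_mod_cast hLge k) (can.a_pos k).le
  refine ⟨L, hL, fun m hm M hM => ?_⟩
  -- a range index containing the masses and the probe
  obtain ⟨K, hKm, hKM⟩ : ∃ K : ℕ, (∀ f, ((K : ℝ) + 1)⁻¹ ≤ m f ∧ m f ≤ K + 1) ∧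
      ((K : ℝ) + 1)⁻¹ ≤ M ∧ M ≤ K + 1 := by
    refine ⟨⌈max (max M M⁻¹) (max (∑ f, m f) (∑ f, (m f)⁻¹))⌉₊, fun f => ⟨?_, ?_⟩, ?_, ?_⟩
    · have h1 : (m f)⁻¹ ≤ ∑ g, (m g)⁻¹ :=
        Finset.single_le_sum (fun g _ => (inv_pos.2 (hm g)).le) (Finset.mem_univ f)
      have h2 : (m f)⁻¹ ≤ (⌈max (max M M⁻¹) (max (∑ f, m f) (∑ f, (m f)⁻¹))⌉₊ : ℝ) + 1 :=
        (h1.trans ((le_max_right _ _).trans ((le_max_right _ _).trans (Nat.le_ceil _)))).trans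
          (by linarith)
      rw [inv_le_comm₀ (by positivity) (hm f)]
      exact h2
    · have h1 : m f ≤ ∑ g, m g := Finset.single_le_sum (fun g _ => (hm g).le) (Finset.mem_univ f)
      exact (h1.trans ((le_max_left _ _).trans ((le_max_right _ _).trans (Nat.le_ceil _)))).trans
        (by linarith)
    · have h2 : M⁻¹ ≤ (⌈max (max M M⁻¹) (max (∑ f, m f) (∑ f, (m f)⁻¹))⌉₊ : ℝ) + 1 :=
        ((le_max_right _ _).trans ((le_max_left _ _).trans (Nat.le_ceil _))).trans (by linarith)
      rw [inv_le_comm₀ (by positivity) hM]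
      exact h2
    · exact ((le_max_left _ _).trans ((le_max_left _ _).trans (Nat.le_ceil _))).trans (by linarith)
  filter_upwards [eventually_ge_atTop (max (k₁ K) K)] with k hk
  have h1 : k₁ K ≤ k := le_of_max_le_left hk
  have h2 : K ≤ k := le_of_max_le_right hk
  have hKs : K ≤ Ks k := Nat.le_findGreatest h2 h1
  have hKs' : k₁ (Ks k) ≤ k := Nat.findGreatest_spec (P := fun K => k₁ K ≤ k) h2 h1
  have hKsR : (K : ℝ) + 1 ≤ (Ks k : ℝ) + 1 := by exact_mod_cast Nat.succ_le_succ hKs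
  have hinv : ((Ks k : ℝ) + 1)⁻¹ ≤ ((K : ℝ) + 1)⁻¹ := inv_anti₀ (by positivity) hKsR
  exact hLP k hKs' m (fun f => ⟨hinv.trans (hKm f).1, (hKm f).2.trans hKsR⟩) M (hinv.trans hKM.1)
    (hKM.2.trans hKsR)

end GlueReduction

/-- **STUB B · `stub_freeSideGlue`** — C⁺ for `N_f = 2, 3` (8964-r3's `FixedCouplingIndexSpreadSub`, verbatim over
`qcdPhaseQuenchedExpect`) implies `LifshitzTight` (the hard stub of line `hermitian-flow-coarea` in DOS form), by the
heavy free-volume (tip) witness `tipReg N_f L'` (`canonicalAF`, `m_crit ≡ 0`, diagonal free volumes): TIGHT is C⁺ read in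
scheme language, `HeavySideDOS` is free at `m_crit ≥ 0`; `TipNoBinding`, `WegnerEstimate` unused. -/
theorem stub_freeSideGlue :
    (∀ Nf : ℕ, (Nf = 2 ∨ Nf = 3) → ∀ Q : ℕ, ∃ h₀ : ℝ, 0 < h₀ ∧ ∀ β lo hi : ℝ, 0 ≤ β → 0 < lo → lo ≤ hi →
      hi ≤ Q * lo → hi * max β 1 ≤ h₀ → ∀ L₀ : ℕ, ∃ L' : ℕ, L₀ ≤ L' ∧ ∀ δ : ℝ, lo ≤ δ → δ ≤ hi →
      ∀ μ : Fin Nf → ℝ, (∀ f, lo ≤ μ f ∧ μ f ≤ hi) → 1 ≤ qcdPhaseQuenchedExpect β (2 * L' + 1) μ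
      (fun U : GaugeConfig 4 (2 * L' + 1) SU3 => |(Multiset.countP (fun z : ℂ => z.re < 0) (spinorLift
      gammaFive * wilsonDirac (fundamentalRep (Fin 3)) U (-δ) 1).charpoly.roots : ℝ) - 6 * (2 * (L' : ℝ) +
      1) ^ 4|)) →
    TipNoBinding → WegnerEstimate → ∀ Nf : ℕ, (Nf = 2 ∨ Nf = 3) → ∃ reg : QCDRegularisation Nf,
      reg.HasMassScaling ∧ (reg.scheme 0 0 0).HasAsymptoticScaling ∧ ∃ M₀ : ℝ, 0 ≤ M₀ ∧ ∃ c : ℝ, 0 <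
      c ∧ ∀ m : Fin Nf → ℝ, (∀ f, M₀ < m f) → (∀ ε : ℝ, 0 < ε → ∀ᶠ k : ℕ in Filter.atTop, ∀ S : ℕ,
      reg.L k ≤ S → ∀ f : Fin Nf, (∃ η₀ : ℝ, 0 < η₀ ∧ ∀ η : ℝ, 0 < η → η < η₀ → (∫ t in (-1 :
      ℝ)..(-(reg.mcrit k + reg.a k * m f / reg.Zm k)), (∫ U, (Multiset.countP (fun z : ℂ => |z.re| <
      η) (spinorLift gammaFive * wilsonDirac (fundamentalRep (Fin 3)) U (-t) 1).charpoly.roots : ℝ)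
      * ∏ f : Fin Nf, ‖fermionDet (wilsonDirac (fundamentalRep (Fin 3)) U (reg.mcrit k + reg.a k * m
      f / reg.Zm k) 1)‖ ∂(wilsonMeasure (fundamentalRep (Fin 3)) (reg.β k) : Measure (GaugeConfig 4
      (2 * S + 1) SU3)))) / (∫ U, ∏ f : Fin Nf, ‖fermionDet (wilsonDirac (fundamentalRep (Fin 3)) U
      (reg.mcrit k + reg.a k * m f / reg.Zm k) 1)‖ ∂(wilsonMeasure (fundamentalRep (Fin 3)) (reg.β
      k) : Measure (GaugeConfig 4 (2 * S + 1) SU3))) ≤ 2 * η * (ε * ((2 * S + 1 : ℝ) / (2 * reg.L k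
      + 1)) ^ 4)) ∧ (∫ U, (Multiset.countP (fun z : ℂ => |z.re| < c * (reg.a k * m f / reg.Zm k))
      (spinorLift gammaFive * wilsonDirac (fundamentalRep (Fin 3)) U (reg.mcrit k + reg.a k * m f /
      reg.Zm k) 1).charpoly.roots : ℝ) * ∏ f : Fin Nf, ‖fermionDet (wilsonDirac (fundamentalRep (Fin
      3)) U (reg.mcrit k + reg.a k * m f / reg.Zm k) 1)‖ ∂(wilsonMeasure (fundamentalRep (Fin 3))
      (reg.β k) : Measure (GaugeConfig 4 (2 * S + 1) SU3))) / (∫ U, ∏ f : Fin Nf, ‖fermionDet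
      (wilsonDirac (fundamentalRep (Fin 3)) U (reg.mcrit k + reg.a k * m f / reg.Zm k) 1)‖
      ∂(wilsonMeasure (fundamentalRep (Fin 3)) (reg.β k) : Measure (GaugeConfig 4 (2 * S + 1) SU3)))
      ≤ ε * ((2 * S + 1 : ℝ) / (2 * reg.L k + 1)) ^ 4) ∧ (∀ M : ℝ, M₀ < M → ∀ᶠ k : ℕ in
      Filter.atTop, 1 ≤ (∫ U, (|(Multiset.countP (fun z : ℂ => z.re < 0) (spinorLift gammaFive *
      wilsonDirac (fundamentalRep (Fin 3)) U (reg.mcrit k - reg.a k * M / reg.Zm k)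
      1).charpoly.roots : ℝ) - 6 * (2 * reg.L k + 1 : ℝ) ^ 4|) * ∏ f : Fin Nf, ‖fermionDet
      (wilsonDirac (fundamentalRep (Fin 3)) U (reg.mcrit k + reg.a k * m f / reg.Zm k) 1)‖
      ∂(wilsonMeasure (fundamentalRep (Fin 3)) (reg.β k) : Measure (GaugeConfig 4 (2 * reg.L k + 1)
      SU3))) / (∫ U, ∏ f : Fin Nf, ‖fermionDet (wilsonDirac (fundamentalRep (Fin 3)) U (reg.mcrit k
      + reg.a k * m f / reg.Zm k) 1)‖ ∂(wilsonMeasure (fundamentalRep (Fin 3)) (reg.β k) : Measure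
      (GaugeConfig 4 (2 * reg.L k + 1) SU3)))) := by
  intro hC _ _ Nf hNf
  have h8 : Nf ≤ 8 := by rcases hNf with rfl | rfl <;> norm_num
  obtain ⟨L', hL', hT⟩ :=
    glue_tight_tipReg_of_schemeIndexSpread (glue_schemeIndexSpread_of_fixedCouplingSub h8 (hC Nf hNf))
  exact ⟨tipReg Nf L' hL', QCDRegularisation.canonicalAF_hasMassScaling,
    QCDScheme.zeroAF_hasAsymptoticScaling, 0, le_rfl, 1, one_pos, fun m hm =>
      ⟨Summit.QuantumFields.QCD.Theorems.TipPricing.Negative.HeavySideDOSFreeSide.heavySideDOS_of_mcrit_nonneg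
          (tipReg Nf L' hL') (fun _ => le_rfl) le_rfl m hm, hT m hm⟩⟩

end Summit.QuantumFields.QCD.Cruxes.TipPricing.HermitianFlowCoarea
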